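import Literature.Computability.Cryptography.HallgrenGiantStep
import HarnessLib

/-!
# Size of the distance correction of Hallgren's giant step

Topic `Computability/Cryptography`; continues `HallgrenGiantStep.lean` (`kappaQ a b`, the correction
in `δ(a * b) = δ(a) + δ(b) + κ`). We bound `|κ|` for elements of the principal cycle by an explicit
function `KQ D = 2(⌊log₂ D⌋ + 7)(⌊log₂ D⌋ + 2)` of the discriminant (Jozsa 2003, §7.2 and §9: the
correction is `O(log D)` per reduction step and there are `O(log D)` steps; Jacobson–Williams (5.12),
(5.38)). Ingredients: `2dQ_c ∣ Q_aQ_b` (so `1 ≤ Q_aQ_b/(2dQ_c) ≤ 4D`), the bounds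
`2^{-K} ≤ |reduceMult| ≤ (20D²)^K` with `K ≤ ⌊log₂ D⌋ + 5` steps, and `1 < φ < 2√D` for reduced
quotients. Theorem-and-definition file, no named facts.

## References

* R. Jozsa, arXiv:quant-ph/0302134 (2003), §7.2, §9. [Jozsa2003]
* M. J. Jacobson, Jr., H. C. Williams, *Solving the Pell Equation*, Springer (2009), (5.12), (5.38). [JacobsonWilliams2008]
-/

noncomputable section

open scoped Classical

namespace Literature.Computability.Cryptography

namespace HallgrenGiantStep

open Literature.NumberTheory.QuadraticFields Literature.NumberTheory.QuadraticFields.QuadIrr HallgrenComposition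

variable {D : ℕ}

/-! ### `2dQ_c ≤ Q_aQ_b` -/

/-- **The content divides the product of the norms**: `2dQ_c ≤ Q_aQ_b` (indeed `2dQ_c ∣ Q_aQ_b`:
`Q_aQ_b ∈ L(a)L(b) = 2dQ_cℤ + 2d(P_c + √D)ℤ` and `√D` is irrational). [cite: Jozsa2003, §7.1 Prop. 34] -/
theorem two_mul_scalar_mul_Q_le (hD : ¬ IsSquare D) (hD4 : D % 4 = 0 ∨ D % 4 = 1) {a b : QuadIrr D}
    (ha : a.IsIdealShaped) (hb : b.IsIdealShaped) :
    2 * compScalar a b * (comp a b).Q ≤ a.Q * b.Q := by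
  have hmem : (a.Q : ℝ) * b.Q ∈ latZ a * latZ b :=
    Submodule.mul_mem_mul (Submodule.subset_span (by simp)) (Submodule.subset_span (by simp))
  rw [latZ_mul_latZ_comp hD4 ha hb, Submodule.mem_span_pair] at hmem
  obtain ⟨m, n, h⟩ := hmem
  simp only [zsmul_eq_mul] at h
  have hd := compScalar_pos (y := b) ha
  have hQc := comp_Q_pos hD4 ha hb
  -- `n = 0` by irrationality of `√D`
  have hn : n = 0 := by
    by_contra hn
    have hirr : Irrational (Real.sqrt D) := by
      rw [show (D : ℝ) = ((D : ℕ) : ℝ) from rfl, irrational_sqrt_natCast_iff]; exact hD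
    apply hirr
    -- solve for `√D`
    have hcoef : (n : ℝ) * (2 * compScalar a b) ≠ 0 := by
      have : (n : ℝ) ≠ 0 := by exact_mod_cast hn
      have : (compScalar a b : ℝ) ≠ 0 := by exact_mod_cast hd.ne'
      positivity
    refine ⟨((a.Q * b.Q - m * (2 * compScalar a b * (comp a b).Q) - n * (2 * compScalar a b * (comp a b).P) : ℤ) : ℚ) /
      ((n * (2 * compScalar a b) : ℤ) : ℚ), ?_⟩
    push_cast
    field_simp
    linarith
  rw [hn] at h
  simp only [Int.cast_zero, zero_mul, add_zero] at h
  -- `Q_aQ_b = m · 2dQ_c` with `m ≥ 1`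
  have hpos : (0 : ℝ) < a.Q * b.Q := by
    have : (0 : ℝ) < a.Q := by exact_mod_cast ha.1
    have : (0 : ℝ) < b.Q := by exact_mod_cast hb.1
    positivity
  have hdc : (0 : ℝ) < 2 * compScalar a b * (comp a b).Q := by
    have : (0 : ℝ) < compScalar a b := by exact_mod_cast hd
    have : (0 : ℝ) < (comp a b).Q := by exact_mod_cast hQc
    positivity
  have hm : (1 : ℝ) ≤ m := by
    have : (0 : ℝ) < m := by
      by_contra hm; push Not at hm
      have : (m : ℝ) * (2 * compScalar a b * (comp a b).Q) ≤ 0 := mul_nonpos_of_nonpos_of_nonneg hm hdc.le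
      linarith
    have : (0 : ℤ) < m := by exact_mod_cast this
    exact_mod_cast (show (1 : ℤ) ≤ m by omega)
  have : (2 * compScalar a b * (comp a b).Q : ℝ) ≤ a.Q * b.Q := by rw [← h]; nlinarith
  exact_mod_cast this

/-! ### Logarithmic bounds -/

/-- `log D ≤ ⌊log₂ D⌋ + 1`. [folklore] -/
theorem log_le_log2_add_one (D : ℕ) : Real.log D ≤ Nat.log 2 D + 1 := by
  rcases Nat.eq_zero_or_pos D with rfl | hD
  · simp
  have hlt : D < 2 ^ (Nat.log 2 D + 1) := Nat.lt_pow_succ_log_self (by norm_num) D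
  have h1 : Real.log D ≤ Real.log ((2 : ℝ) ^ (Nat.log 2 D + 1)) :=
    Real.log_le_log (by exact_mod_cast hD) (by exact_mod_cast hlt.le)
  rw [Real.log_pow] at h1
  have h2 : Real.log 2 ≤ 1 := by
    have := Real.log_le_sub_one_of_pos (by norm_num : (0 : ℝ) < 2); linarith
  calc Real.log D ≤ (Nat.log 2 D + 1 : ℕ) * Real.log 2 := h1
    _ ≤ (Nat.log 2 D + 1 : ℕ) * 1 := by gcongr
    _ = Nat.log 2 D + 1 := by push_cast; ring

/-- `0 < log φ ≤ 1 + log D` for a reduced quotient (`1 < φ < 2√D`). [cite: Jozsa2003, §6.1 Prop. 17] -/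
theorem log_val_bounds (hD : ¬ IsSquare D) {x : QuadIrr D} (h : x.IsReduced) :
    0 < Real.log x.val ∧ Real.log x.val ≤ 1 + Real.log D := by
  have hv := h.2.2.1
  refine ⟨Real.log_pos hv, ?_⟩
  have hQ : (1 : ℝ) ≤ x.Q := by exact_mod_cast h.1
  have hP := h.P_lt_sqrt
  have hD1 : (1 : ℝ) ≤ D := by
    have h0 : D ≠ 0 := fun h0 => hD (h0 ▸ ⟨0, rfl⟩)
    exact_mod_cast Nat.one_le_iff_ne_zero.mpr h0
  have hsq : (1 : ℝ) ≤ Real.sqrt D := by rw [Real.one_le_sqrt]; exact hD1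
  have hval : x.val ≤ 2 * Real.sqrt D := by
    unfold val
    rw [div_le_iff₀ (by linarith)]
    nlinarith
  calc Real.log x.val ≤ Real.log (2 * Real.sqrt D) := Real.log_le_log (by linarith) hval
    _ = Real.log 2 + Real.log D / 2 := by
        rw [Real.log_mul (by norm_num) (by positivity), Real.log_sqrt (by positivity)]
    _ ≤ 1 + Real.log D := by
        have := Real.log_le_sub_one_of_pos (by norm_num : (0 : ℝ) < 2)
        have : 0 ≤ Real.log D := Real.log_nonneg hD1
        linarith

/-- `1 ≤ D` for a non-square. [folklore] -/
theorem one_le_D (hD : ¬ IsSquare D) : (1 : ℝ) ≤ D := by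
  have h0 : D ≠ 0 := fun h0 => hD (h0 ▸ ⟨0, rfl⟩)
  exact_mod_cast Nat.one_le_iff_ne_zero.mpr h0

/-- **Size of the composed quotient**: `Q_c < 2D` (from `2dQ_c ≤ Q_aQ_b < 4D`). [cite: Jozsa2003, §7.1 Prop. 34] -/
theorem comp_Q_lt (hD : ¬ IsSquare D) (hD4 : D % 4 = 0 ∨ D % 4 = 1) {a b : QuadIrr D}
    (ha : a.IsIdealShaped) (hb : b.IsIdealShaped) (hra : a.IsReduced) (hrb : b.IsReduced) :
    ((comp a b).Q : ℝ) < 2 * D ∧ (1 : ℝ) ≤ (a.Q : ℝ) * b.Q / (2 * compScalar a b * (comp a b).Q) ∧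
      (a.Q : ℝ) * b.Q / (2 * compScalar a b * (comp a b).Q) < 2 * D := by
  have hle : (2 * compScalar a b * (comp a b).Q : ℝ) ≤ a.Q * b.Q := by
    exact_mod_cast two_mul_scalar_mul_Q_le hD hD4 ha hb
  have hd : (1 : ℝ) ≤ compScalar a b := by exact_mod_cast compScalar_pos (y := b) ha
  have hQc : (1 : ℝ) ≤ (comp a b).Q := by exact_mod_cast comp_Q_pos hD4 ha hb
  have hQa := hra.Q_lt_two_sqrt
  have hQb := hrb.Q_lt_two_sqrt
  have hQa0 : (0 : ℝ) < a.Q := by exact_mod_cast ha.1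
  have hQb0 : (0 : ℝ) < b.Q := by exact_mod_cast hb.1
  have hsq : Real.sqrt D ^ 2 = D := Real.sq_sqrt (Nat.cast_nonneg _)
  have hab : (a.Q : ℝ) * b.Q < 4 * D := by nlinarith
  have h2 : (2 : ℝ) ≤ 2 * compScalar a b * (comp a b).Q := by nlinarith
  refine ⟨by nlinarith, ?_, ?_⟩
  · rw [le_div_iff₀ (by positivity)]; linarith
  · rw [div_lt_iff₀ (by positivity)]
    have hD0 : (0 : ℝ) ≤ D := Nat.cast_nonneg _
    nlinarith

/-- **The number of reduction steps** is `≤ ⌊log₂ D⌋ + 5` when `0 < Q ≤ 2D`. [cite: JacobsonWilliams2008, §5.1 (K = O(log Q))] -/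
theorem gaussSteps_le (hD : ¬ IsSquare D) {x : QuadIrr D} (hQ : 0 < x.Q) (hQD : (x.Q : ℝ) ≤ 2 * D) :
    gaussSteps x ≤ Nat.log 2 D + 5 := by
  unfold gaussSteps
  have h0 : D ≠ 0 := fun h0 => hD (h0 ▸ ⟨0, rfl⟩)
  have hQn : x.Q.toNat ≤ 2 * D := by
    have : (x.Q : ℝ) = ((x.Q.toNat : ℕ) : ℝ) := by
      rw [← Int.toNat_of_nonneg hQ.le]; push_cast; rw [Int.toNat_of_nonneg hQ.le]
    rw [this] at hQD
    exact_mod_cast hQD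
  have h1 : Nat.log 4 x.Q.toNat ≤ Nat.log 4 (2 * D) := Nat.log_mono_right hQn
  have h2 : Nat.log 4 (2 * D) ≤ Nat.log 2 (2 * D) := Nat.log_anti_left (by norm_num) (by norm_num)
  have h3 : Nat.log 2 (2 * D) = Nat.log 2 D + 1 := by
    rw [mul_comm]; exact Nat.log_mul_base (by norm_num) h0
  omega

/-- **The reduction multiplier in logarithm**: `|log|reduceMult x|| ≤ K · log(6D²)` when
`0 < Q ≤ 2D` (`2^{-K} ≤ |reduceMult| ≤ (M(√D + M))^K`, `M = max Q √D ≤ 2D`).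
[cite: JacobsonWilliams2008, (5.12), (5.38)] -/
theorem abs_log_reduceMult_le (hD : ¬ IsSquare D) {x : QuadIrr D} (h : x.IsAdmissible) (hQ : 0 < x.Q)
    (hQD : (x.Q : ℝ) ≤ 2 * D) :
    |Real.log (|reduceMult x|)| ≤ gaussSteps x * Real.log (6 * (D : ℝ) ^ 2) := by
  have hD1 := one_le_D hD
  have hlo := le_abs_reduceMult hD h hQ
  have hhi := abs_reduceMult_le hD h hQ
  have hr : 0 < |reduceMult x| := abs_pos.mpr (reduceMult_ne_zero hD h hQ)
  set K := gaussSteps x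
  have hsqD : Real.sqrt D ≤ D := by
    rw [Real.sqrt_le_left (by linarith)]; nlinarith
  have hM : max (x.Q : ℝ) (Real.sqrt D) ≤ 2 * D := max_le hQD (by linarith)
  have hM0 : 0 ≤ max (x.Q : ℝ) (Real.sqrt D) := le_max_of_le_right (Real.sqrt_nonneg _)
  have hbase : max 1 (max (x.Q : ℝ) (Real.sqrt D) * (Real.sqrt D + max (x.Q : ℝ) (Real.sqrt D))) ≤ 6 * (D : ℝ) ^ 2 := by
    refine max_le (by nlinarith) ?_
    calc max (x.Q : ℝ) (Real.sqrt D) * (Real.sqrt D + max (x.Q : ℝ) (Real.sqrt D))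
        ≤ (2 * D) * (D + 2 * D) := mul_le_mul hM (by linarith) (by positivity) (by positivity)
      _ = 6 * (D : ℝ) ^ 2 := by ring
  have h6 : (1 : ℝ) ≤ 6 * (D : ℝ) ^ 2 := by nlinarith
  have hlog6 : 0 ≤ Real.log (6 * (D : ℝ) ^ 2) := Real.log_nonneg h6
  rw [abs_le]
  constructor
  · -- lower: `log|r| ≥ K log(1/2) ≥ −K log(6D²)`
    have h1 : Real.log ((1 / 2 : ℝ) ^ K) ≤ Real.log |reduceMult x| := Real.log_le_log (by positivity) hlo
    rw [Real.log_pow] at h1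
    have h2 : -Real.log (6 * (D : ℝ) ^ 2) ≤ Real.log (1 / 2 : ℝ) := by
      rw [one_div, Real.log_inv, neg_le_neg_iff]
      exact Real.log_le_log (by norm_num) (by nlinarith)
    have : (K : ℝ) * -Real.log (6 * (D : ℝ) ^ 2) ≤ K * Real.log (1 / 2 : ℝ) := mul_le_mul_of_nonneg_left h2 (Nat.cast_nonneg _)
    linarith
  · have h1 : Real.log |reduceMult x| ≤ Real.log ((max 1 (max (x.Q : ℝ) (Real.sqrt D) *
        (Real.sqrt D + max (x.Q : ℝ) (Real.sqrt D)))) ^ K) := Real.log_le_log hr hhi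
    rw [Real.log_pow] at h1
    have h2 : Real.log (max 1 (max (x.Q : ℝ) (Real.sqrt D) * (Real.sqrt D + max (x.Q : ℝ) (Real.sqrt D)))) ≤
        Real.log (6 * (D : ℝ) ^ 2) := Real.log_le_log (by positivity) hbase
    have : (K : ℝ) * Real.log (max 1 (max (x.Q : ℝ) (Real.sqrt D) * (Real.sqrt D + max (x.Q : ℝ) (Real.sqrt D)))) ≤
        K * Real.log (6 * (D : ℝ) ^ 2) := mul_le_mul_of_nonneg_left h2 (Nat.cast_nonneg _)
    linarith

/-! ### The bound on the correction -/

/-- **The bound `K(D) = 2(⌊log₂ D⌋ + 7)(⌊log₂ D⌋ + 2)`** on the distance correction. [cite: Jozsa2003, §9 (the corrections are O(poly log D))] -/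
def KQ (D : ℕ) : ℚ := ((2 * (Nat.log 2 D + 7) * (Nat.log 2 D + 2) : ℕ) : ℚ)

/-- **The distance correction of the giant step is bounded**: `|κ(a, b)| ≤ K(D)` for elements of
the principal cycle. [cite: Jozsa2003, §7.2, §9] [cite: JacobsonWilliams2008, (5.12), (5.38)] -/
theorem abs_kappaQ_le (hD : ¬ IsSquare D) (hD4 : D % 4 = 0 ∨ D % 4 = 1) (i j : ℕ) :
    |kappaQ (step^[i] (principalFirst D)) (step^[j] (principalFirst D))| ≤ (KQ D : ℝ) := by
  set a := step^[i] (principalFirst D)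
  set b := step^[j] (principalFirst D)
  have ha : a.IsIdealShaped := isIdealShaped_cycle hD hD4 i
  have hb : b.IsIdealShaped := isIdealShaped_cycle hD hD4 j
  have hra : a.IsReduced := isReduced_iterate hD (isReduced_principalFirst hD hD4) i
  have hrb : b.IsReduced := isReduced_iterate hD (isReduced_principalFirst hD hD4) j
  have hcQ : 0 < (comp a b).Q := comp_Q_pos hD4 ha hb
  have hcadm : (comp a b).IsAdmissible := (isIdealShaped_comp hD4 ha hb).isAdmissible
  have hrw : (starQ a b).IsReduced := isReduced_reduce hD hcadm hcQ
  obtain ⟨hQc, hμ1, hμ2⟩ := comp_Q_lt hD hD4 ha hb hra hrb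
  have hD1 := one_le_D hD
  -- the pieces
  have hr := abs_log_reduceMult_le hD hcadm hcQ hQc.le
  have hK := gaussSteps_le hD hcQ hQc.le
  obtain ⟨hva0, hva1⟩ := log_val_bounds hD hra
  obtain ⟨hvb0, hvb1⟩ := log_val_bounds hD hrb
  obtain ⟨hvw0, hvw1⟩ := log_val_bounds hD hrw
  have hlogD := log_le_log2_add_one D
  have hμlo : 0 ≤ Real.log ((a.Q : ℝ) * b.Q / (2 * compScalar a b * (comp a b).Q)) := Real.log_nonneg hμ1
  have hμhi : Real.log ((a.Q : ℝ) * b.Q / (2 * compScalar a b * (comp a b).Q)) ≤ 1 + Real.log D := by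
    calc _ ≤ Real.log (2 * D) := Real.log_le_log (by linarith) hμ2.le
      _ = Real.log 2 + Real.log D := Real.log_mul (by norm_num) (by positivity)
      _ ≤ 1 + Real.log D := by
          have := Real.log_le_sub_one_of_pos (by norm_num : (0 : ℝ) < 2); linarith
  have hlog6 : Real.log (6 * (D : ℝ) ^ 2) ≤ 2 + 2 * Real.log D := by
    rw [Real.log_mul (by norm_num) (by positivity), Real.log_pow]
    have : Real.log 6 ≤ 2 := by
      -- `6 ≤ (1 + 1 + 1/2)² ≤ (exp 1)² = exp 2`
      rw [Real.log_le_iff_le_exp (by norm_num)]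
      have h1 : (1 : ℝ) + 1 + 1 ^ 2 / 2 ≤ Real.exp 1 := Real.quadratic_le_exp_of_nonneg (by norm_num)
      have h2 : Real.exp 2 = Real.exp 1 * Real.exp 1 := by rw [← Real.exp_add]; norm_num
      rw [h2]; nlinarith [Real.exp_pos 1]
    push_cast; linarith
  have hlogD0 : 0 ≤ Real.log D := Real.log_nonneg hD1
  -- assemble
  set ℓ : ℝ := (Nat.log 2 D : ℝ) with hℓ
  have hℓ0 : 0 ≤ ℓ := Nat.cast_nonneg _
  have hKr : (gaussSteps (comp a b) : ℝ) ≤ ℓ + 5 := by rw [hℓ]; exact_mod_cast hK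
  have hr' : |Real.log (|reduceMult (comp a b)|)| ≤ (ℓ + 5) * (2 + 2 * (ℓ + 1)) := by
    refine hr.trans ?_
    have h6 : 0 ≤ Real.log (6 * (D : ℝ) ^ 2) := Real.log_nonneg (by nlinarith)
    calc (gaussSteps (comp a b) : ℝ) * Real.log (6 * (D : ℝ) ^ 2) ≤ (ℓ + 5) * Real.log (6 * (D : ℝ) ^ 2) :=
          mul_le_mul_of_nonneg_right hKr h6
      _ ≤ (ℓ + 5) * (2 + 2 * (ℓ + 1)) := mul_le_mul_of_nonneg_left (by linarith) (by linarith)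
  have hKQ : (KQ D : ℝ) = 2 * (ℓ + 7) * (ℓ + 2) := by rw [KQ, hℓ]; push_cast; ring
  rw [hKQ, abs_le]
  rw [abs_le] at hr'
  unfold kappaQ
  constructor <;> nlinarith [hr'.1, hr'.2]

end HallgrenGiantStep

end Literature.Computability.Cryptography

end
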